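import Summits.AtomisticToContinuum.FouriersLaw.Theses.HeatModeWeylLaw
import Summits.AtomisticToContinuum.FouriersLaw.Theorems.OddSectorIrreversibilityOddDensityIsCorrectorAdjoint

/-!
# Krein symmetry of the equilibrium Langevin-chain generator (route `HeatModeWeylLaw`, item
`KreinSymmetry`, stmt-AtomisticToContinuum-12400)

DETAILED BALANCE WITH MOMENTUM FLIP. For every oscillator chain `P` with `C¹` potentials, every
`N`, `T > 0` (and integrable Gibbs density), and test functions `f, g ∈ C²_c`,

  `∫ f · (L g) dμ_T = ∫ g · ((L (f∘Θ))∘Θ) dμ_T`,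

where `L = P.generator N T T` is the generator with both baths at temperature `T`,
`Θ = momentumReversal N : (q, p) ↦ (q, -p)` and `μ_T = P.gibbsMeasure N T = volume.tilted (-H/T)`;
i.e. `L† = Θ L Θ` in `L²(μ_T)`, so that `L` is formally self-adjoint for the Krein form
`[f, g] := ⟨Θ f, g⟩` (Hérau–Hitrik–Sjöstrand 2011, §3.1, Props. 3.1–3.2).

Proof: `∫ · dμ_T = (∫ e^{-H/T})⁻¹ ∫ · e^{-H/T} dx` (`OscillatorChain.integral_gibbsMeasure`), and the
Lebesgue-density form of the identity is the tree's
`OddSectorIrreversibility.integral_generator_mul_eq_reversal` (Liouville part antisymmetric and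
odd under `Θ`, each Ornstein–Uhlenbeck bath term symmetric and even; two integrations by parts per
site against `e^{-H/T}`, valid for `C¹` potentials, any `γ`, any `N`, `T ≠ 0`).

References: Hérau–Hitrik–Sjöstrand 2011 §3.1; Bonetto–Lebowitz–Rey-Bellet 2000 §4.1;
Kundu–Dhar–Narayan 2009 eq. (reln2). No definitions.
-/

noncomputable section

namespace Summit.AtomisticToContinuum.FouriersLaw.Theorems

open MeasureTheory
open Literature.MathematicalPhysics.KineticTheory.HeatConduction

/-- **Krein symmetry / detailed balance with momentum flip** (closes item
stmt-AtomisticToContinuum-12400, decl `HeatModeWeylLaw.KreinSymmetry`): for every oscillator chain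
with `C¹` potentials, `T > 0`, integrable Gibbs density and `f, g ∈ C²_c`,
`∫ f·(L_{T,T} g) dμ_T = ∫ g·((L_{T,T}(f∘Θ))∘Θ) dμ_T`, `Θ(q,p) = (q,-p)`.
[cite: HerauHitrikSjostrand2011, §3.1 Props. 3.1–3.2] -/
theorem kreinSymmetry_proof :
    Summit.AtomisticToContinuum.FouriersLaw.Theses.HeatModeWeylLaw.KreinSymmetry := by
  unfold Summit.AtomisticToContinuum.FouriersLaw.Theses.HeatModeWeylLaw.KreinSymmetry
  intro P hU hV N T hT _hρ f g hf _hfc hg hgc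
  rw [P.integral_gibbsMeasure, P.integral_gibbsMeasure]
  congr 1
  have h := OddSectorIrreversibility.integral_generator_mul_eq_reversal P hU hV N T hT.ne' hg hgc hf
  calc ∫ x, f x * P.generator N T T g x * P.gibbsDensity N T x
      = ∫ x, P.generator N T T g x * f x * P.gibbsDensity N T x := by
        congr 1
        funext x
        ring
    _ = ∫ x, g x * P.generator N T T (fun y : PhaseSpace N => f (y.1, -y.2)) (x.1, -x.2) *
          P.gibbsDensity N T x := h
    _ = ∫ x, g x * P.generator N T T (fun y => f (momentumReversal N y)) (momentumReversal N x) *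
          P.gibbsDensity N T x := by
        simp only [momentumReversal_apply]

end Summit.AtomisticToContinuum.FouriersLaw.Theorems

end
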